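import Literature.Analysis.FunctionSpaces.TorusClassicalNSUniqueness
import Literature.Analysis.FunctionSpaces.TorusSpaceTime
import Literature.Analysis.FunctionSpaces.TorusCalculusProofs
import Literature.Analysis.FunctionSpaces.TorusEnstrophyOrthogonality
import HarnessLib

/-!
# Stub `stub_compactLimitsOfShifts` of the line `SketchIdeator2`, part A: limits of classical
# Navier–Stokes solutions on `T³` whose space–time 2-jets converge are classical solutions
# (crux stmt-AnomalousDissipation-14249, `MarginalStabilityChain.ChainRealisation`)

First helper file of the lead's stub B5 (`stub_compactLimitsOfShifts`: compact limits of
time-translates of a forward classical solution).  Everything here is elementary plumbing between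
the torus calculus of `Literature.Analysis.FunctionSpaces.Torus` (slices) and the space–time lifts
`stLift u (t, y) = u t (proj y)` on `S × ℝ³`:

* `clsA_integral_norm_sub_sq_le`, `clsA_gradNormSq_sub_le` — uniform smallness of a difference of
  two smooth slices and of its first partial derivatives gives smallness in `L²` and in `H¹`
  (`gradNormSq`), the form in which the phase construction consumes convergence;
* `clsA_hasZeroMean_of_tendsto` — mean zero passes to `L²` limits;
* `clsA_limit_isClassicalNSSolutionOn` — **limits of classical solutions are classical**: if
  `(uₙ, pₙ)` are classical solutions of NS_ν with the steady force `F` on `S × T³` (`S = Ici a`),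
  `v, q` are jointly smooth on `S × T³`, and at every point of `S × ℝ³` the values, the first and
  the second derivatives within `S × ℝ³` of `stLift uₙ` converge to those of `stLift v` and the
  first derivatives of `stLift pₙ` to those of `stLift q`, then `(v, q)` is a classical solution on
  `S` (each term of the momentum equation and the divergence is a continuous function of the
  2-jet of the lift: `IsSmoothSpaceTimeOn.timeDerivWithin_apply_proj`, `….fderiv_slice_apply`,
  `Torus.fderiv_apply_eq_sum_partialDeriv`, `Torus.laplacian_eq_sum_partialDeriv_partialDeriv`,
  `Torus.gradient_eq_sum_partialDeriv`).

References: C. Foias, O. Manley, R. Rosa, R. Temam, *Navier–Stokes Equations and Turbulence*,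
CUP 2001, Ch. III §2 (the dynamical system of strong solutions); J. Dieudonné, *Foundations of
Modern Analysis*, (8.6.3).
-/

set_option linter.dupNamespace false

noncomputable section

open MeasureTheory Set Filter Topology
open scoped InnerProductSpace
open Literature.Analysis.FunctionSpaces Literature.Analysis.FunctionSpaces.Torus

namespace Summit.AnomalousDissipation.AnomalousDissipation.Theorems.ChainRealisation.SeparatrixFluxPinning

/-! ## §A.1 Smallness in `L²` and `H¹` from uniform smallness of slices -/

/-- On the probability space `T³`, a pointwise bound `‖f x‖ ≤ δ` gives `∫ ‖f‖² ≤ δ²`. -/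
theorem clsA_integral_norm_sq_le_of_forall_le {G : Type*} [NormedAddCommGroup G]
    {f : (UnitAddTorus (Fin 3)) → G} {δ : ℝ} (h : ∀ x, ‖f x‖ ≤ δ) :
    ∫ x, ‖f x‖ ^ 2 ≤ δ ^ 2 := by
  have hle : ∀ x, ‖f x‖ ^ 2 ≤ δ ^ 2 := fun x =>
    pow_le_pow_left₀ (norm_nonneg _) (h x) 2
  calc ∫ x, ‖f x‖ ^ 2 ≤ ∫ _ : (UnitAddTorus (Fin 3)), δ ^ 2 := by
        by_cases hf : Integrable (fun x => ‖f x‖ ^ 2) volume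
        · exact integral_mono hf (integrable_const _) hle
        · rw [integral_undef hf]
          exact integral_nonneg fun _ => sq_nonneg _
    _ = δ ^ 2 := by simp

/-- Uniform smallness of a difference of slices gives smallness in `L²(T³)`. -/
theorem clsA_integral_norm_sub_sq_le {f g : (UnitAddTorus (Fin 3)) → (EuclideanSpace ℝ (Fin 3))} {δ : ℝ}
    (h : ∀ x, ‖f x - g x‖ ≤ δ) : ∫ x, ‖f x - g x‖ ^ 2 ≤ δ ^ 2 :=
  clsA_integral_norm_sq_le_of_forall_le (f := fun x => f x - g x) h

/-- Uniform smallness of the first partial derivatives of a difference of smooth slices gives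
smallness of its `gradNormSq` (`= ∫ ∑ᵢ ‖∂ᵢ·‖²`): `gradNormSq (f − g) ≤ 3 δ²`. -/
theorem clsA_gradNormSq_sub_le {f g : (UnitAddTorus (Fin 3)) → (EuclideanSpace ℝ (Fin 3))} (hf : IsSmooth f) (hg : IsSmooth g) {δ : ℝ}
    (h : ∀ i x, ‖partialDeriv i f x - partialDeriv i g x‖ ≤ δ) :
    gradNormSq (fun x => f x - g x) ≤ 3 * δ ^ 2 := by
  have hfg : (fun x => f x - g x) = f - g := rfl
  have hsub : ∀ i, partialDeriv i (fun x => f x - g x) = partialDeriv i f - partialDeriv i g :=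
    fun i => by
      rw [hfg]
      exact partialDeriv_sub (hf.isContDiff (by simp)) (hg.isContDiff (by simp)) i
  unfold gradNormSq
  have hle : ∀ x, ∑ i, ‖partialDeriv i (fun x => f x - g x) x‖ ^ 2 ≤ 3 * δ ^ 2 := by
    intro x
    calc ∑ i, ‖partialDeriv i (fun x => f x - g x) x‖ ^ 2 ≤ ∑ _i : Fin 3, δ ^ 2 := by
          refine Finset.sum_le_sum fun i _ => ?_
          rw [hsub i, Pi.sub_apply]
          exact pow_le_pow_left₀ (norm_nonneg _) (h i x) 2
      _ = 3 * δ ^ 2 := by simp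
  calc ∫ x, ∑ i, ‖partialDeriv i (fun x => f x - g x) x‖ ^ 2 ≤ ∫ _ : (UnitAddTorus (Fin 3)), 3 * δ ^ 2 := by
        by_cases hI : Integrable (fun x => ∑ i, ‖partialDeriv i (fun x => f x - g x) x‖ ^ 2) volume
        · exact integral_mono hI (integrable_const _) hle
        · rw [integral_undef hI]
          exact integral_nonneg fun _ => by positivity
    _ = 3 * δ ^ 2 := by simp

/-! ## §A.2 Mean zero passes to `L²` limits -/

/-- On the probability space `T³`, `‖∫ f‖² ≤ ∫ ‖f‖²` for square-integrable `f`. -/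
theorem clsA_norm_integral_sq_le {f : (UnitAddTorus (Fin 3)) → (EuclideanSpace ℝ (Fin 3))} (hf : MemLp f 2 volume) :
    ‖∫ x, f x‖ ^ 2 ≤ ∫ x, ‖f x‖ ^ 2 := by
  have h1 : ‖∫ x, f x‖ ≤ ∫ x, ‖f x‖ := norm_integral_le_integral_norm _
  have hint : Integrable (fun x => ‖f x‖) volume := (hf.integrable one_le_two).norm
  -- Jensen / Cauchy–Schwarz on a probability space: `(∫ ‖f‖)² ≤ ∫ ‖f‖²`
  have h2 : (∫ x, ‖f x‖) ^ 2 ≤ ∫ x, ‖f x‖ ^ 2 := by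
    have hcs := integral_mul_le_Lp_mul_Lq_of_nonneg (μ := (volume : Measure (UnitAddTorus (Fin 3))))
      Real.HolderConjugate.two_two (f := fun x => ‖f x‖) (g := fun _ => (1 : ℝ))
      (Eventually.of_forall fun _ => norm_nonneg _) (Eventually.of_forall fun _ => zero_le_one)
      (by simpa using hf.norm) (memLp_const 1)
    simp only [mul_one, integral_const, smul_eq_mul, Real.one_rpow] at hcs
    have h0 : 0 ≤ ∫ x, ‖f x‖ := integral_nonneg fun _ => norm_nonneg _
    have hI0 : 0 ≤ ∫ x, ‖f x‖ ^ 2 := integral_nonneg fun _ => sq_nonneg _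
    have h3 : (∫ x, ‖f x‖) ≤ (∫ x, ‖f x‖ ^ 2) ^ (1 / 2 : ℝ) := by
      have : (∫ x, ‖f x‖ ^ (2 : ℝ)) = ∫ x, ‖f x‖ ^ 2 := by
        refine integral_congr_ae (Eventually.of_forall fun x => ?_)
        simp
      simpa [this] using hcs
    calc (∫ x, ‖f x‖) ^ 2 ≤ ((∫ x, ‖f x‖ ^ 2) ^ (1 / 2 : ℝ)) ^ 2 :=
          pow_le_pow_left₀ h0 h3 2
      _ = ∫ x, ‖f x‖ ^ 2 := by
          rw [← Real.rpow_natCast, ← Real.rpow_mul hI0]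
          norm_num
  exact (pow_le_pow_left₀ (norm_nonneg _) h1 2).trans h2

/-- Mean zero passes to limits in `L²(T³)`: if every `fₙ` has zero mean and `∫ ‖fₙ − g‖² → 0`
for smooth `fₙ`, `g`, then `g` has zero mean. -/
theorem clsA_hasZeroMean_of_tendsto {f : ℕ → (UnitAddTorus (Fin 3)) → (EuclideanSpace ℝ (Fin 3))} {g : (UnitAddTorus (Fin 3)) → (EuclideanSpace ℝ (Fin 3))}
    (hf : ∀ n, IsSmooth (f n)) (hg : IsSmooth g) (h0 : ∀ n, HasZeroMean (f n))
    (hlim : Tendsto (fun n => ∫ x, ‖f n x - g x‖ ^ 2) atTop (𝓝 0)) : HasZeroMean g := by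
  unfold HasZeroMean at h0 ⊢
  have hkey : ∀ n, ‖∫ x, g x‖ ^ 2 ≤ ∫ x, ‖f n x - g x‖ ^ 2 := by
    intro n
    have hsub : ∫ x, g x = -(∫ x, (f n x - g x)) := by
      rw [integral_sub (hf n).integrable hg.integrable, h0 n, zero_sub, neg_neg]
    rw [hsub, norm_neg]
    exact clsA_norm_integral_sq_le (((hf n).memLp 2).sub (hg.memLp 2))
  have hle : ‖∫ x, g x‖ ^ 2 ≤ 0 :=
    ge_of_tendsto hlim (Eventually.of_forall hkey)
  have : ‖∫ x, g x‖ = 0 := by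
    have h : ‖∫ x, g x‖ ^ 2 = 0 := le_antisymm hle (sq_nonneg _)
    exact (pow_eq_zero_iff (n := 2) (by norm_num)).1 h
  exact norm_eq_zero.1 this

/-! ## §A.3 Jets of slices through the space–time lift -/

section Jets

variable {G : Type*} [NormedAddCommGroup G] [NormedSpace ℝ G]

/-- Evaluation at a fixed vector is continuous along a convergent sequence of operators. -/
theorem clsA_tendsto_clm_apply {V : Type*} [NormedAddCommGroup V] [NormedSpace ℝ V]
    {A : ℕ → V →L[ℝ] G} {A₀ : V →L[ℝ] G} (h : Tendsto A atTop (𝓝 A₀)) (w : V) :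
    Tendsto (fun n => A n w) atTop (𝓝 (A₀ w)) :=
  ((ContinuousLinearMap.apply ℝ G w).continuous.tendsto A₀).comp h

variable {S : Set ℝ} {w : ℝ → (UnitAddTorus (Fin 3)) → G}

/-- First spatial partial derivatives of a slice through the lift:
`∂ᵢ(w t)(proj y) = D_{S×ℝ³}(stLift w)(t,y)(0, eᵢ)`. -/
theorem clsA_partialDeriv_slice_eq (hw : IsSmoothSpaceTimeOn S w) {t : ℝ} (ht : t ∈ S)
    (y : (EuclideanSpace ℝ (Fin 3))) (i : Fin 3) :
    partialDeriv i (w t) (proj y) =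
      fderivWithin ℝ (stLift w) (S ×ˢ univ) (t, y) (0, EuclideanSpace.single i 1) := by
  rw [partialDeriv_eq_fderiv_apply ((hw.isSmooth_slice ht).isContDiff (by simp)),
    hw.fderiv_slice_apply ht]

/-- Second spatial partial derivatives of a slice through the lift:
`∂ᵢ∂ⱼ(w t)(proj y) = D²_{S×ℝ³}(stLift w)(t,y)(0,eᵢ)(0,eⱼ)` (on time sets of unique
differentiability). -/
theorem clsA_partialDeriv_partialDeriv_slice_eq (hw : IsSmoothSpaceTimeOn S w) (hS : UniqueDiffOn ℝ S)
    {t : ℝ} (ht : t ∈ S) (y : (EuclideanSpace ℝ (Fin 3))) (i j : Fin 3) :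
    partialDeriv i (partialDeriv j (w t)) (proj y) =
      fderivWithin ℝ (fderivWithin ℝ (stLift w) (S ×ˢ univ)) (S ×ˢ univ) (t, y)
        (0, EuclideanSpace.single i 1) (0, EuclideanSpace.single j 1) := by
  have hU : UniqueDiffOn ℝ (S ×ˢ (univ : Set (EuclideanSpace ℝ (Fin 3)))) := hS.prod uniqueDiffOn_univ
  have hz : (t, y) ∈ S ×ˢ (univ : Set (EuclideanSpace ℝ (Fin 3))) := mk_mem_prod ht (mem_univ _)
  have hW : IsSmoothSpaceTimeOn S (fun s => partialDeriv j (w s)) := hw.partialDeriv hS j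
  rw [clsA_partialDeriv_slice_eq hW ht y i]
  -- the lift of `∂ⱼ w` agrees on `S × ℝ³` with `z ↦ D(stLift w)(z)(0, eⱼ)`
  have heq : EqOn (stLift fun s => partialDeriv j (w s))
      (fun z => fderivWithin ℝ (stLift w) (S ×ˢ univ) z (0, EuclideanSpace.single j 1))
      (S ×ˢ (univ : Set (EuclideanSpace ℝ (Fin 3)))) := by
    rintro ⟨s, y'⟩ hz'
    exact clsA_partialDeriv_slice_eq hw (mem_prod.1 hz').1 y' j
  rw [fderivWithin_congr heq (heq hz)]
  have hA : DifferentiableWithinAt ℝ (fun z => fderivWithin ℝ (stLift w) (S ×ˢ univ) z)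
      (S ×ˢ univ) (t, y) :=
    ((hw.fderivWithin hU (m := 1) (by norm_cast)).differentiableOn (by norm_num)) _ hz
  rw [fderivWithin_clm_apply (hU _ hz) hA (differentiableWithinAt_const _)]
  simp [fderivWithin_const_apply]

end Jets

/-! ## §A.4 Limits of classical solutions are classical -/

/-- **Limits of classical Navier–Stokes solutions whose 2-jets converge are classical.**  Let
`(uₙ, pₙ)` be classical solutions of NS_ν with the steady force `F` on `Ici a × T³`, and `v`, `q`
jointly smooth there.  If at every point of `Ici a × ℝ³` the values and the first two derivatives
(within `Ici a × ℝ³`) of `stLift uₙ` converge to those of `stLift v`, and the first derivatives of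
`stLift pₙ` to those of `stLift q`, then `(v, q)` is a classical solution on `Ici a`. -/
theorem clsA_limit_isClassicalNSSolutionOn {a ν : ℝ} {F : (UnitAddTorus (Fin 3)) → (EuclideanSpace ℝ (Fin 3))}
    {u : ℕ → ℝ → (UnitAddTorus (Fin 3)) → (EuclideanSpace ℝ (Fin 3))} {p : ℕ → ℝ → (UnitAddTorus (Fin 3)) → ℝ} {v : ℝ → (UnitAddTorus (Fin 3)) → (EuclideanSpace ℝ (Fin 3))} {q : ℝ → (UnitAddTorus (Fin 3)) → ℝ}
    (hsol : ∀ n, IsClassicalNSSolutionOn (Ici a) ν (fun _ => F) (u n) (p n))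
    (hv : IsSmoothSpaceTimeOn (Ici a) v) (hq : IsSmoothSpaceTimeOn (Ici a) q)
    (h0 : ∀ z ∈ Ici a ×ˢ (univ : Set (EuclideanSpace ℝ (Fin 3))), Tendsto (fun n => stLift (u n) z) atTop (𝓝 (stLift v z)))
    (h1 : ∀ z ∈ Ici a ×ˢ (univ : Set (EuclideanSpace ℝ (Fin 3))),
      Tendsto (fun n => fderivWithin ℝ (stLift (u n)) (Ici a ×ˢ univ) z) atTop
        (𝓝 (fderivWithin ℝ (stLift v) (Ici a ×ˢ univ) z)))
    (h2 : ∀ z ∈ Ici a ×ˢ (univ : Set (EuclideanSpace ℝ (Fin 3))),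
      Tendsto (fun n => fderivWithin ℝ (fderivWithin ℝ (stLift (u n)) (Ici a ×ˢ univ)) (Ici a ×ˢ univ) z)
        atTop (𝓝 (fderivWithin ℝ (fderivWithin ℝ (stLift v) (Ici a ×ˢ univ)) (Ici a ×ˢ univ) z)))
    (hp1 : ∀ z ∈ Ici a ×ˢ (univ : Set (EuclideanSpace ℝ (Fin 3))),
      Tendsto (fun n => fderivWithin ℝ (stLift (p n)) (Ici a ×ˢ univ) z) atTop
        (𝓝 (fderivWithin ℝ (stLift q) (Ici a ×ˢ univ) z))) :
    IsClassicalNSSolutionOn (Ici a) ν (fun _ => F) v q := by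
  have hS : UniqueDiffOn ℝ (Ici a) := uniqueDiffOn_Ici a
  set D : Set (ℝ × (EuclideanSpace ℝ (Fin 3))) := Ici a ×ˢ univ with hD
  refine ⟨hv, hq, ?_, ?_⟩
  · -- momentum equation
    intro t ht x
    set y : (EuclideanSpace ℝ (Fin 3)) := repr x with hy
    have hx : proj y = x := proj_repr x
    have hz : (t, y) ∈ D := mk_mem_prod ht (mem_univ _)
    -- notation for the jets
    set A : ℕ → (ℝ × (EuclideanSpace ℝ (Fin 3))) →L[ℝ] (EuclideanSpace ℝ (Fin 3)) := fun n => fderivWithin ℝ (stLift (u n)) D (t, y) with hA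
    set A₀ : (ℝ × (EuclideanSpace ℝ (Fin 3))) →L[ℝ] (EuclideanSpace ℝ (Fin 3)) := fderivWithin ℝ (stLift v) D (t, y) with hA₀
    set B : ℕ → (ℝ × (EuclideanSpace ℝ (Fin 3))) →L[ℝ] (ℝ × (EuclideanSpace ℝ (Fin 3))) →L[ℝ] (EuclideanSpace ℝ (Fin 3)) :=
      fun n => fderivWithin ℝ (fderivWithin ℝ (stLift (u n)) D) D (t, y) with hB
    set B₀ : (ℝ × (EuclideanSpace ℝ (Fin 3))) →L[ℝ] (ℝ × (EuclideanSpace ℝ (Fin 3))) →L[ℝ] (EuclideanSpace ℝ (Fin 3)) :=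
      fderivWithin ℝ (fderivWithin ℝ (stLift v) D) D (t, y) with hB₀
    set P : ℕ → (ℝ × (EuclideanSpace ℝ (Fin 3))) →L[ℝ] ℝ := fun n => fderivWithin ℝ (stLift (p n)) D (t, y) with hP
    set P₀ : (ℝ × (EuclideanSpace ℝ (Fin 3))) →L[ℝ] ℝ := fderivWithin ℝ (stLift q) D (t, y) with hP₀
    have hAt : Tendsto A atTop (𝓝 A₀) := h1 _ hz
    have hBt : Tendsto B atTop (𝓝 B₀) := h2 _ hz
    have hPt : Tendsto P atTop (𝓝 P₀) := hp1 _ hz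
    have hVt : Tendsto (fun n => stLift (u n) (t, y)) atTop (𝓝 (stLift v (t, y))) := h0 _ hz
    -- each term of the momentum equation through the jets
    have key : ∀ (w : ℝ → (UnitAddTorus (Fin 3)) → (EuclideanSpace ℝ (Fin 3))) (r : ℝ → (UnitAddTorus (Fin 3)) → ℝ), IsSmoothSpaceTimeOn (Ici a) w →
        IsSmoothSpaceTimeOn (Ici a) r →
        timeDerivWithin (Ici a) w t x = fderivWithin ℝ (stLift w) D (t, y) (1, 0) ∧
        convect (w t) (w t) x =
          ∑ i, (stLift w (t, y)) i • fderivWithin ℝ (stLift w) D (t, y) (0, EuclideanSpace.single i 1) ∧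
        laplacian (w t) x =
          ∑ i, fderivWithin ℝ (fderivWithin ℝ (stLift w) D) D (t, y)
            (0, EuclideanSpace.single i 1) (0, EuclideanSpace.single i 1) ∧
        gradient (r t) x =
          ∑ i, fderivWithin ℝ (stLift r) D (t, y) (0, EuclideanSpace.single i 1) •
            EuclideanSpace.single i (1 : ℝ) := by
      intro w r hw hr
      have hws : IsSmooth (w t) := hw.isSmooth_slice ht
      have hrs : IsSmooth (r t) := hr.isSmooth_slice ht
      refine ⟨?_, ?_, ?_, ?_⟩
      · rw [← hx]; exact hw.timeDerivWithin_apply_proj hS ht y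
      · rw [Torus.convect, fderiv_apply_eq_sum_partialDeriv (hws.isContDiff (by simp))]
        refine Finset.sum_congr rfl fun i _ => ?_
        rw [← hx, clsA_partialDeriv_slice_eq hw ht y i]
        rfl
      · rw [laplacian_eq_sum_partialDeriv_partialDeriv hws]
        refine Finset.sum_congr rfl fun i _ => ?_
        rw [← hx, clsA_partialDeriv_partialDeriv_slice_eq hw hS ht y i i]
      · rw [gradient_eq_sum_partialDeriv (hrs.isContDiff (by simp))]
        refine Finset.sum_congr rfl fun i _ => ?_
        rw [← hx, clsA_partialDeriv_slice_eq hr ht y i]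
    -- the equation for each `n`, rewritten through the jets
    have heqn : ∀ n, A n (1, 0) + ∑ i, (stLift (u n) (t, y)) i • A n (0, EuclideanSpace.single i 1) =
        ν • ∑ i, B n (0, EuclideanSpace.single i 1) (0, EuclideanSpace.single i 1) -
          ∑ i, P n (0, EuclideanSpace.single i 1) • EuclideanSpace.single i (1 : ℝ) + F x := by
      intro n
      obtain ⟨k1, k2, k3, k4⟩ := key (u n) (p n) (hsol n).smooth_velocity (hsol n).smooth_pressure
      have hm := (hsol n).momentum t ht x
      rw [k1, k2, k3, k4] at hm
      exact hm
    -- pass to the limit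
    have hL : Tendsto (fun n => A n (1, 0) + ∑ i, (stLift (u n) (t, y)) i • A n (0, EuclideanSpace.single i 1))
        atTop (𝓝 (A₀ (1, 0) + ∑ i, (stLift v (t, y)) i • A₀ (0, EuclideanSpace.single i 1))) := by
      refine (clsA_tendsto_clm_apply hAt _).add (tendsto_finsetSum _ fun i _ => ?_)
      have hc : Tendsto (fun n => (stLift (u n) (t, y)) i) atTop (𝓝 ((stLift v (t, y)) i)) :=
        ((EuclideanSpace.proj i).continuous.tendsto _).comp hVt
      exact hc.smul (clsA_tendsto_clm_apply hAt _)
    have hR : Tendsto (fun n => ν • ∑ i, B n (0, EuclideanSpace.single i 1) (0, EuclideanSpace.single i 1) -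
          ∑ i, P n (0, EuclideanSpace.single i 1) • EuclideanSpace.single i (1 : ℝ) + F x)
        atTop (𝓝 (ν • ∑ i, B₀ (0, EuclideanSpace.single i 1) (0, EuclideanSpace.single i 1) -
          ∑ i, P₀ (0, EuclideanSpace.single i 1) • EuclideanSpace.single i (1 : ℝ) + F x)) := by
      refine ((Tendsto.const_smul (tendsto_finsetSum _ fun i _ => ?_) ν).sub
        (tendsto_finsetSum _ fun i _ => ?_)).add tendsto_const_nhds
      · exact clsA_tendsto_clm_apply (clsA_tendsto_clm_apply hBt _) _
      · exact (clsA_tendsto_clm_apply hPt _).smul tendsto_const_nhds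
    have hlim := tendsto_nhds_unique hL (hR.congr fun n => (heqn n).symm)
    obtain ⟨k1, k2, k3, k4⟩ := key v q hv hq
    rw [k1, k2, k3, k4]
    exact hlim
  · -- divergence free
    intro t ht x
    set y : (EuclideanSpace ℝ (Fin 3)) := repr x with hy
    have hx : proj y = x := proj_repr x
    have hz : (t, y) ∈ D := mk_mem_prod ht (mem_univ _)
    have hdivn : ∀ n, ∑ i, (fderivWithin ℝ (stLift (u n)) D (t, y) (0, EuclideanSpace.single i 1)) i = 0 := by
      intro n
      have h := (hsol n).divFree t ht x
      rw [divergence_eq_sum_partialDeriv_apply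
        (((hsol n).smooth_velocity.isSmooth_slice ht).isContDiff (by simp))] at h
      calc ∑ i, (fderivWithin ℝ (stLift (u n)) D (t, y) (0, EuclideanSpace.single i 1)) i
          = ∑ i, (partialDeriv i (u n t) x) i := by
            refine Finset.sum_congr rfl fun i _ => ?_
            rw [← hx, clsA_partialDeriv_slice_eq (hsol n).smooth_velocity ht y i]
        _ = 0 := h
    have hlim : Tendsto (fun n => ∑ i, (fderivWithin ℝ (stLift (u n)) D (t, y) (0, EuclideanSpace.single i 1)) i)
        atTop (𝓝 (∑ i, (fderivWithin ℝ (stLift v) D (t, y) (0, EuclideanSpace.single i 1)) i)) :=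
      tendsto_finsetSum _ fun i _ =>
        ((EuclideanSpace.proj i).continuous.tendsto _).comp (clsA_tendsto_clm_apply (h1 _ hz) _)
    have h0' : ∑ i, (fderivWithin ℝ (stLift v) D (t, y) (0, EuclideanSpace.single i 1)) i = 0 :=
      tendsto_nhds_unique hlim (by simp only [hdivn]; exact tendsto_const_nhds)
    rw [divergence_eq_sum_partialDeriv_apply ((hv.isSmooth_slice ht).isContDiff (by simp))]
    rw [← h0']
    refine Finset.sum_congr rfl fun i _ => ?_
    rw [← hx, clsA_partialDeriv_slice_eq hv ht y i]

/-- Registered form (explicit binders) of `clsA_limit_isClassicalNSSolutionOn`: **limits of classical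
Navier–Stokes solutions on `T³` whose space–time 2-jets converge pointwise are classical solutions.** -/
theorem clsA_limitClassical :
    ∀ (a ν : ℝ) (F : UnitAddTorus (Fin 3) → EuclideanSpace ℝ (Fin 3))
      (u : ℕ → ℝ → UnitAddTorus (Fin 3) → EuclideanSpace ℝ (Fin 3)) (p : ℕ → ℝ → UnitAddTorus (Fin 3) → ℝ)
      (v : ℝ → UnitAddTorus (Fin 3) → EuclideanSpace ℝ (Fin 3)) (q : ℝ → UnitAddTorus (Fin 3) → ℝ),
      (∀ n, IsClassicalNSSolutionOn (Set.Ici a) ν (fun _ => F) (u n) (p n)) →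
      IsSmoothSpaceTimeOn (Set.Ici a) v → IsSmoothSpaceTimeOn (Set.Ici a) q →
      (∀ z ∈ Set.Ici a ×ˢ (Set.univ : Set (EuclideanSpace ℝ (Fin 3))),
        Tendsto (fun n => stLift (u n) z) atTop (𝓝 (stLift v z))) →
      (∀ z ∈ Set.Ici a ×ˢ (Set.univ : Set (EuclideanSpace ℝ (Fin 3))),
        Tendsto (fun n => fderivWithin ℝ (stLift (u n)) (Set.Ici a ×ˢ Set.univ) z) atTop
          (𝓝 (fderivWithin ℝ (stLift v) (Set.Ici a ×ˢ Set.univ) z))) →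
      (∀ z ∈ Set.Ici a ×ˢ (Set.univ : Set (EuclideanSpace ℝ (Fin 3))),
        Tendsto (fun n => fderivWithin ℝ (fderivWithin ℝ (stLift (u n)) (Set.Ici a ×ˢ Set.univ))
          (Set.Ici a ×ˢ Set.univ) z) atTop
          (𝓝 (fderivWithin ℝ (fderivWithin ℝ (stLift v) (Set.Ici a ×ˢ Set.univ)) (Set.Ici a ×ˢ Set.univ) z))) →
      (∀ z ∈ Set.Ici a ×ˢ (Set.univ : Set (EuclideanSpace ℝ (Fin 3))),
        Tendsto (fun n => fderivWithin ℝ (stLift (p n)) (Set.Ici a ×ˢ Set.univ) z) atTop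
          (𝓝 (fderivWithin ℝ (stLift q) (Set.Ici a ×ˢ Set.univ) z))) →
      IsClassicalNSSolutionOn (Set.Ici a) ν (fun _ => F) v q :=
  fun _ _ _ _ _ _ _ hsol hv hq h0 h1 h2 hp1 => clsA_limit_isClassicalNSSolutionOn hsol hv hq h0 h1 h2 hp1


end Summit.AnomalousDissipation.AnomalousDissipation.Theorems.ChainRealisation.SeparatrixFluxPinning

end
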